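import Literature.NumberTheory.LFunctions.TuringMethodTuringBound
import Literature.NumberTheory.LFunctions.SelbergFujiiMoments
import Literature.NumberTheory.LFunctions.SchoenfeldZeroSums
import Summits.RiemannHypothesis.RiemannHypothesis.Theorems.LiCoefficientsDefs
import HarnessLib

/-!
# RiemannHypothesis / LiCoefficients — crux `LiWindowLowerBound`, part C (RH-FREE): Turing's bound by parts (S5)

`|∫_{b/2}^b S(t) f_n'(t) dt| ≤ (2.30 + 0.128 log(b/2π)) (4n/b² + (7/3) n²/b³)` for `n ≥ 1`, `b ≥ 1100`:
with `F(t) = ∫_{b/2}^t S` (TURING: `|F| ≤ 2.30 + 0.128 log(t/2π)`, `abs_integral_zetaArgS_le_turing_holds`,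
`b/2 > 168π`), `∫ S f' = F(b) f'(b) − ∫ F f''` (FTC with RIGHT derivatives: `S = N − ϑ/π − 1` is
right-continuous since the ordinates are discrete), `|f'(b)| ≤ n/b²`, `|f''| ≤ n²/t⁴ + 2n/t³`.

RH-FREE [rh-li-prover]: every input is a proved tree theorem about the zeros of `ζ` (zero counting, Backlund's explicit
`S(t)` bound, Turing's bound, Stirling for `ϑ`); no hypothesis on the real parts of the zeros is used.  Part of the
PROOF-OF-DATA rung L-P(P1) of the RH ladder's column LI; nothing here bears on the truth of RH.
-/

noncomputable section

-- D-0017: `Summit.<S>.<S>.…` is the designed namespace of a single-problem summit.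
set_option linter.dupNamespace false

open Real Set MeasureTheory intervalIntegral Filter
open scoped Real Topology

namespace Summit.RiemannHypothesis.RiemannHypothesis.Theorems.LiTheory

open Literature.NumberTheory.LFunctions Literature.NumberTheory.LFunctions.SchoenfeldBound

namespace Window

/-! ### Right-continuity of `N` and `S`; the primitive of `S` -/

/-- `N` is locally constant to the right: `N(u) = N(t)` for `u` slightly above `t ≥ 0`. -/
theorem zetaZeroCount_eventuallyEq_nhdsGT {t : ℝ} (ht : 0 ≤ t) :
    ∀ᶠ u in 𝓝[>] t, (zetaZeroCount u : ℝ) = zetaZeroCount t := by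
  classical
  obtain ⟨t₁, ht₁, hfree⟩ : ∃ t₁, t < t₁ ∧ ∀ ρ ∈ zerosBetween t (t + 1), t₁ ≤ ρ.im := by
    by_cases hne : (zerosBetween t (t + 1)).Nonempty
    · obtain ⟨ρ₀, hρ₀, hmin⟩ := Finset.exists_min_image (zerosBetween t (t + 1)) (fun ρ ↦ ρ.im) hne
      obtain ⟨-, -, -, h3, -⟩ := (mem_zerosBetween ht).1 hρ₀
      exact ⟨ρ₀.im, h3, fun ρ hρ ↦ hmin ρ hρ⟩
    · exact ⟨t + 1, by linarith, fun ρ hρ ↦ absurd ⟨ρ, hρ⟩ hne⟩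
  have hmem : Ioo t (min t₁ (t + 1)) ∈ 𝓝[>] t := Ioo_mem_nhdsGT (lt_min ht₁ (by linarith))
  filter_upwards [hmem] with u hu
  have hu1 : u < t₁ := lt_of_lt_of_le hu.2 (min_le_left _ _)
  have hu2 : u ≤ t + 1 := (lt_of_lt_of_le hu.2 (min_le_right _ _)).le
  have hempty : zerosBetween t u = ∅ := by
    rw [Finset.eq_empty_iff_forall_notMem]
    intro ρ hρ
    obtain ⟨hz, h0, h1, h3, h4⟩ := (mem_zerosBetween ht).1 hρ
    have hρ' : ρ ∈ zerosBetween t (t + 1) := (mem_zerosBetween ht).2 ⟨hz, h0, h1, h3, h4.trans hu2⟩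
    have := hfree ρ hρ'
    linarith
  have h := zetaZeroCount_sub_eq_sum (T₁ := t) (T₂ := u) hu.1.le
  rw [hempty, Finset.sum_empty] at h
  linarith

/-- `S` is continuous from the right at every `t ≥ 0`. -/
theorem continuousWithinAt_zetaArgS_Ioi {t : ℝ} (ht : 0 ≤ t) : ContinuousWithinAt zetaArgS (Ioi t) t := by
  have hN : Tendsto (fun u ↦ (zetaZeroCount u : ℝ)) (𝓝[>] t) (𝓝 (zetaZeroCount t : ℝ)) :=
    (tendsto_congr' (zetaZeroCount_eventuallyEq_nhdsGT ht)).2 tendsto_const_nhds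
  have hθ : Tendsto (fun u ↦ riemannSiegelTheta u / π + 1) (𝓝[>] t)
      (𝓝 (riemannSiegelTheta t / π + 1)) :=
    ((continuous_riemannSiegelTheta.div_const π).add continuous_const).continuousAt.continuousWithinAt
  have e : zetaArgS = fun u ↦ (zetaZeroCount u : ℝ) - (riemannSiegelTheta u / π + 1) := by
    funext u; simp only [zetaArgS]; ring
  show Tendsto zetaArgS (𝓝[>] t) (𝓝 (zetaArgS t))
  rw [e]
  exact hN.sub hθ

/-- The primitive `F(u) = ∫_a^u S` has right derivative `S(t)` at every `t ≥ 0`. -/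
theorem hasDerivWithinAt_primitive_zetaArgS (a : ℝ) {t : ℝ} (ht : 0 ≤ t) :
    HasDerivWithinAt (fun u ↦ ∫ x in a..u, zetaArgS x) (zetaArgS t) (Ioi t) t := by
  have h := intervalIntegral.integral_hasDerivWithinAt_right (intervalIntegrable_zetaArgS a t)
    (s := Ici t) (t := Ioi t) (SelbergFujii.measurable_zetaArgS.aestronglyMeasurable.stronglyMeasurableAtFilter)
    (continuousWithinAt_zetaArgS_Ioi ht)
  exact h.mono Ioi_subset_Ici_self

/-- **Integration by parts against `S`** (FTC with right derivatives): for `0 ≤ a ≤ b` and `g ∈ C¹[a,b]`,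
`∫_a^b S g = F(b) g(b) − ∫_a^b F g'`, `F(u) = ∫_a^u S`. -/
theorem integral_zetaArgS_mul_eq {a b : ℝ} (ha : 0 ≤ a) (hab : a ≤ b) {g g' : ℝ → ℝ}
    (hg : ∀ t ∈ Icc a b, HasDerivAt g (g' t) t) (hg' : ContinuousOn g' (Icc a b)) :
    ∫ t in a..b, zetaArgS t * g t =
      (∫ t in a..b, zetaArgS t) * g b - ∫ t in a..b, (∫ x in a..t, zetaArgS x) * g' t := by
  set F : ℝ → ℝ := fun u ↦ ∫ x in a..u, zetaArgS x with hF
  have hFcont : Continuous F :=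
    intervalIntegral.continuous_primitive (fun a b ↦ intervalIntegrable_zetaArgS a b) a
  have hgcont : ContinuousOn g (Icc a b) := fun t ht ↦ (hg t ht).continuousAt.continuousWithinAt
  have hderiv : ∀ t ∈ Ioo a b,
      HasDerivWithinAt (fun u ↦ F u * g u) (zetaArgS t * g t + F t * g' t) (Ioi t) t := by
    intro t ht
    have h1 := hasDerivWithinAt_primitive_zetaArgS a (ha.trans ht.1.le)
    have h2 := (hg t ⟨ht.1.le, ht.2.le⟩).hasDerivWithinAt (s := Ioi t)
    exact h1.mul h2
  have hSg : IntervalIntegrable (fun t ↦ zetaArgS t * g t) volume a b :=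
    (intervalIntegrable_zetaArgS a b).mul_continuousOn (by rwa [uIcc_of_le hab])
  have hFg' : IntervalIntegrable (fun t ↦ F t * g' t) volume a b :=
    (hFcont.continuousOn.mul hg').intervalIntegrable_of_Icc hab
  have hFTC := intervalIntegral.integral_eq_sub_of_hasDeriv_right_of_le hab
    (hFcont.continuousOn.mul hgcont) hderiv (hSg.add hFg')
  have hFa : F a = 0 := intervalIntegral.integral_same
  rw [intervalIntegral.integral_add hSg hFg'] at hFTC
  simp only [Pi.mul_apply, hFa, zero_mul, sub_zero] at hFTC
  linarith

/-! ### Calculus of the weight: `f''` and its size -/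

/-- `f_n''(t) = 16 n² cos(nθ)/(4t²+1)² + 32 n t sin(nθ)/(4t²+1)²`. -/
def liWindowWeightDeriv2 (n : ℕ) (t : ℝ) : ℝ :=
  16 * n ^ 2 * Real.cos (n * liZeroAngle t) / (4 * t ^ 2 + 1) ^ 2
    + 32 * n * t * Real.sin (n * liZeroAngle t) / (4 * t ^ 2 + 1) ^ 2

/-- `(f_n')' = f_n''` away from `0`. -/
theorem hasDerivAt_liWindowWeightDeriv (n : ℕ) {t : ℝ} (ht : t ≠ 0) :
    HasDerivAt (liWindowWeightDeriv n) (liWindowWeightDeriv2 n t) t := by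
  have h4t : (4 : ℝ) * t ^ 2 + 1 ≠ 0 := by positivity
  have hθ := hasDerivAt_liZeroAngle ht
  have hs : HasDerivAt (fun y ↦ Real.sin (n * liZeroAngle y))
      (Real.cos (n * liZeroAngle t) * (n * (-4 / (4 * t ^ 2 + 1)))) t := (hθ.const_mul (n : ℝ)).sin
  have hp : HasDerivAt (fun y : ℝ ↦ 4 * y ^ 2 + 1) (4 * (2 * t ^ 1 * 1) + 0) t :=
    (((hasDerivAt_id' t).pow 2).const_mul 4).add (hasDerivAt_const t 1)
  have hq : HasDerivAt (fun y : ℝ ↦ -4 / (4 * y ^ 2 + 1))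
      ((0 * (4 * t ^ 2 + 1) - (-4) * (4 * (2 * t ^ 1 * 1) + 0)) / (4 * t ^ 2 + 1) ^ 2) t :=
    (hasDerivAt_const t (-4 : ℝ)).div hp h4t
  have h := ((hs.const_mul (n : ℝ)).mul hq)
  have e : liWindowWeightDeriv n = fun y ↦ (n : ℝ) * Real.sin (n * liZeroAngle y) * (-4 / (4 * y ^ 2 + 1)) := by
    funext y; rfl
  rw [e]
  refine h.congr_deriv ?_
  simp only [liWindowWeightDeriv2]
  field_simp
  ring

/-- `f_n''` is continuous on `[a, b]`, `a > 0`. -/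
theorem continuousOn_liWindowWeightDeriv2 (n : ℕ) {a b : ℝ} (ha : 0 < a) :
    ContinuousOn (liWindowWeightDeriv2 n) (Icc a b) := by
  have hθ : ContinuousOn liZeroAngle (Icc a b) := fun t ht ↦
    (hasDerivAt_liZeroAngle (by linarith [ht.1] : t ≠ 0)).continuousAt.continuousWithinAt
  have hnθ : ContinuousOn (fun t : ℝ ↦ (n : ℝ) * liZeroAngle t) (Icc a b) := continuousOn_const.mul hθ
  have hcos := Real.continuous_cos.comp_continuousOn hnθ
  have hsin := Real.continuous_sin.comp_continuousOn hnθ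
  have hden : ContinuousOn (fun t : ℝ ↦ (4 * t ^ 2 + 1) ^ 2) (Icc a b) := by fun_prop
  have hden0 : ∀ t ∈ Icc a b, (4 * t ^ 2 + 1) ^ 2 ≠ 0 := fun t _ ↦ by positivity
  unfold liWindowWeightDeriv2
  exact ((continuousOn_const.mul hcos).div hden hden0).add
    (((continuousOn_const.mul continuousOn_id).mul hsin).div hden hden0)

/-- `|f_n'(t)| ≤ n/t²` for `t > 0`. -/
theorem abs_liWindowWeightDeriv_le (n : ℕ) {t : ℝ} (ht : 0 < t) :
    |liWindowWeightDeriv n t| ≤ n / t ^ 2 := by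
  unfold liWindowWeightDeriv
  rw [abs_mul, abs_mul, Nat.abs_cast]
  have hs := Real.abs_sin_le_one (n * liZeroAngle t)
  have h4 : |(-4 : ℝ) / (4 * t ^ 2 + 1)| = 4 / (4 * t ^ 2 + 1) := by
    rw [abs_div, abs_of_pos (by positivity : (0:ℝ) < 4 * t ^ 2 + 1)]; norm_num
  rw [h4]
  have hfrac : 4 / (4 * t ^ 2 + 1) ≤ 1 / t ^ 2 := by
    rw [div_le_div_iff₀ (by positivity) (by positivity)]; nlinarith
  have hn : (0 : ℝ) ≤ n := n.cast_nonneg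
  calc (n : ℝ) * |Real.sin (n * liZeroAngle t)| * (4 / (4 * t ^ 2 + 1))
      ≤ n * 1 * (1 / t ^ 2) := by gcongr
    _ = n / t ^ 2 := by ring

/-- `|f_n''(t)| ≤ n²/t⁴ + 2n/t³` for `t > 0`. -/
theorem abs_liWindowWeightDeriv2_le (n : ℕ) {t : ℝ} (ht : 0 < t) :
    |liWindowWeightDeriv2 n t| ≤ n ^ 2 / t ^ 4 + 2 * n / t ^ 3 := by
  unfold liWindowWeightDeriv2
  have hc := Real.abs_cos_le_one (n * liZeroAngle t)
  have hs := Real.abs_sin_le_one (n * liZeroAngle t)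
  have hD : (0 : ℝ) < (4 * t ^ 2 + 1) ^ 2 := by positivity
  have hD16 : 16 * t ^ 4 ≤ (4 * t ^ 2 + 1) ^ 2 := by nlinarith [sq_nonneg t]
  have hn : (0 : ℝ) ≤ n := n.cast_nonneg
  refine (abs_add_le _ _).trans (add_le_add ?_ ?_)
  · rw [abs_div, abs_of_pos hD, abs_mul, abs_of_nonneg (by positivity : (0:ℝ) ≤ 16 * n ^ 2)]
    rw [div_le_div_iff₀ hD (by positivity)]
    calc 16 * (n : ℝ) ^ 2 * |Real.cos (n * liZeroAngle t)| * t ^ 4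
        ≤ 16 * (n : ℝ) ^ 2 * 1 * t ^ 4 := by gcongr
      _ ≤ (n : ℝ) ^ 2 * (4 * t ^ 2 + 1) ^ 2 := by nlinarith [sq_nonneg (n : ℝ)]
  · rw [abs_div, abs_of_pos hD, abs_mul, abs_of_nonneg (by positivity : (0:ℝ) ≤ 32 * n * t)]
    rw [div_le_div_iff₀ hD (by positivity)]
    calc 32 * (n : ℝ) * t * |Real.sin (n * liZeroAngle t)| * t ^ 3
        ≤ 32 * (n : ℝ) * t * 1 * t ^ 3 := by gcongr
      _ ≤ 2 * (n : ℝ) * (4 * t ^ 2 + 1) ^ 2 := by nlinarith [mul_nonneg hn ht.le]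

/-- `∫_{b/2}^b (n²/t⁴ + 2n/t³) dt = (7/3) n²/b³ + 3n/b²` (`b > 0`). -/
theorem integral_bound_eq (n : ℕ) {b : ℝ} (hb : 0 < b) :
    ∫ t in (b / 2)..b, ((n : ℝ) ^ 2 / t ^ 4 + 2 * n / t ^ 3) = 7 / 3 * n ^ 2 / b ^ 3 + 3 * n / b ^ 2 := by
  have hderiv : ∀ t ∈ uIcc (b / 2) b,
      HasDerivAt (fun y : ℝ ↦ -(n : ℝ) ^ 2 / 3 * (y ^ 3)⁻¹ - n * (y ^ 2)⁻¹)
        ((n : ℝ) ^ 2 / t ^ 4 + 2 * n / t ^ 3) t := by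
    intro t ht
    rw [uIcc_of_le (by linarith)] at ht
    have ht0 : t ≠ 0 := by linarith [ht.1]
    have h3 : HasDerivAt (fun y : ℝ ↦ (y ^ 3)⁻¹) (-(↑3 * t ^ (3 - 1)) / (t ^ 3) ^ 2) t :=
      (hasDerivAt_pow 3 t).inv (pow_ne_zero 3 ht0)
    have h2 : HasDerivAt (fun y : ℝ ↦ (y ^ 2)⁻¹) (-(↑2 * t ^ (2 - 1)) / (t ^ 2) ^ 2) t :=
      (hasDerivAt_pow 2 t).inv (pow_ne_zero 2 ht0)
    have h := (h3.const_mul (-(n : ℝ) ^ 2 / 3)).sub (h2.const_mul (n : ℝ))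
    refine h.congr_deriv ?_
    field_simp
    ring
  have hint : IntervalIntegrable (fun t ↦ (n : ℝ) ^ 2 / t ^ 4 + 2 * n / t ^ 3) volume (b / 2) b := by
    refine (continuousOn_of_forall_continuousAt fun t ht ↦ ?_).intervalIntegrable
    rw [uIcc_of_le (by linarith)] at ht
    have ht0 : t ≠ 0 := by linarith [ht.1]
    have h3 : t ^ 3 ≠ 0 := pow_ne_zero 3 ht0
    have h4 : t ^ 4 ≠ 0 := pow_ne_zero 4 ht0
    fun_prop (disch := assumption)
  rw [integral_eq_sub_of_hasDerivAt hderiv hint]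
  field_simp
  ring

/-! ### S5 -/

/-- **S5 (Turing by parts).**  For `b ≥ 1100` (and any `n`),
`|∫_{b/2}^b S(t) f_n'(t) dt| ≤ (2.30 + 0.128 log(b/2π)) (4n/b² + (7/3) n²/b³)`. -/
theorem turingByParts (n : ℕ) {b : ℝ} (hb : 1100 ≤ b) :
    |∫ t in (b / 2)..b, zetaArgS t * liWindowWeightDeriv n t| ≤
      (2.30 + 0.128 * Real.log (b / (2 * Real.pi))) * (4 * n / b ^ 2 + 7 / 3 * n ^ 2 / b ^ 3) := by
  have hπ := Real.pi_lt_d4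
  have hb0 : 0 < b := by linarith
  have ha0 : 0 < b / 2 := by linarith
  have hab : b / 2 ≤ b := by linarith
  set a := b / 2 with ha
  set A := 2.30 + 0.128 * Real.log (b / (2 * Real.pi)) with hA
  -- Turing's bound on the primitive
  have hlog_nonneg : 0 ≤ Real.log (b / (2 * Real.pi)) :=
    Real.log_nonneg (by rw [le_div_iff₀ (by positivity)]; linarith)
  have hA0 : 0 ≤ A := add_nonneg (by norm_num) (mul_nonneg (by norm_num) hlog_nonneg)
  have hF : ∀ u ∈ Icc a b, |∫ x in a..u, zetaArgS x| ≤ A := by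
    intro u hu
    rcases eq_or_lt_of_le hu.1 with h | h
    · rw [← h, intervalIntegral.integral_same, abs_zero]; exact hA0
    · have h168 : 168 * π < a := by rw [ha]; linarith
      have hT := abs_integral_zetaArgS_le_turing_holds h168 h
      have hlog : Real.log (u / (2 * π)) ≤ Real.log (b / (2 * π)) :=
        Real.log_le_log (div_pos (lt_of_lt_of_le ha0 hu.1) (by positivity)) (by gcongr; exact hu.2)
      linarith
  -- by parts
  have hparts := integral_zetaArgS_mul_eq ha0.le hab
    (g := liWindowWeightDeriv n) (g' := liWindowWeightDeriv2 n)
    (fun t ht ↦ hasDerivAt_liWindowWeightDeriv n (by linarith [ht.1] : t ≠ 0))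
    (continuousOn_liWindowWeightDeriv2 n ha0)
  rw [hparts]
  -- the boundary term
  have h1 : |(∫ t in a..b, zetaArgS t) * liWindowWeightDeriv n b| ≤ A * (n / b ^ 2) := by
    rw [abs_mul]
    exact mul_le_mul (hF b ⟨hab, le_rfl⟩) (abs_liWindowWeightDeriv_le n hb0) (abs_nonneg _) hA0
  -- the integral term
  have h2 : |∫ t in a..b, (∫ x in a..t, zetaArgS x) * liWindowWeightDeriv2 n t| ≤
      A * (7 / 3 * n ^ 2 / b ^ 3 + 3 * n / b ^ 2) := by
    have hint : IntervalIntegrable (fun t ↦ A * ((n : ℝ) ^ 2 / t ^ 4 + 2 * n / t ^ 3)) volume a b := by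
      refine ((continuousOn_of_forall_continuousAt fun t ht ↦ ?_).intervalIntegrable)
      rw [uIcc_of_le hab] at ht
      have ht0 : t ≠ 0 := by linarith [ht.1]
      have h3 : t ^ 3 ≠ 0 := pow_ne_zero 3 ht0
      have h4 : t ^ 4 ≠ 0 := pow_ne_zero 4 ht0
      fun_prop (disch := assumption)
    have hle : ∀ᵐ t ∂volume, t ∈ Ioc a b →
        ‖(∫ x in a..t, zetaArgS x) * liWindowWeightDeriv2 n t‖ ≤ A * ((n : ℝ) ^ 2 / t ^ 4 + 2 * n / t ^ 3) :=
      Filter.Eventually.of_forall fun t ht ↦ by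
        rw [Real.norm_eq_abs, abs_mul]
        have ht0 : 0 < t := lt_trans ha0 ht.1
        exact mul_le_mul (hF t ⟨ht.1.le, ht.2⟩) (abs_liWindowWeightDeriv2_le n ht0) (abs_nonneg _) hA0
    have hbound := intervalIntegral.norm_integral_le_of_norm_le hab hle hint
    rw [intervalIntegral.integral_const_mul, integral_bound_eq n hb0, Real.norm_eq_abs] at hbound
    exact hbound
  have h3 := abs_sub _ _ |>.trans (add_le_add h1 h2)
  refine h3.trans (le_of_eq ?_)
  ring

end Window

end Summit.RiemannHypothesis.RiemannHypothesis.Theorems.LiTheory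

end
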